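import Summits.HodgeConjecture.HodgeConjecture.Theorems.SignSymmetricPowersLinkTransport
import Literature.AlgebraicGeometry.HodgeTheory.PicardLefschetzSymmetricA3
import Literature.AlgebraicGeometry.Motives.UniversalHypersurfaceBaseChart
import Literature.AlgebraicGeometry.HodgeTheory.MonomialSupportedHypersurfaceInvariantCycles
import HarnessLib

/-!
# K1-B piece LINK-G, part (B2): the symmetric `A₃` confluence read at a base point of the ι-even family
# (route `SignSymmetricPowers`, item stmt-HodgeConjecture-19716)

Line `andre-zariski`, skeleton v12f (`276eda50fce4ca90`); helper file for the registered stub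
`stub_signConfluenceLinkG` (LINK-G), landed `--supports stmt-HodgeConjecture-19716`.  Notation as in
`SignSymmetricPowersLinkTransport`.

* §3 `exists_confluenceLoops` — for a symmetric `A₃` datum `(f₁, g₀, g₂, j, k, γ)` of `M`-supported forms
  (`IsSymmetricA3Datum`, with `g₀(q) = 0 ⇒ ∇g₀(q) = 0`, e.g. `g₀ = x_j^d`) and its bifurcation `(εa, εb, ψ)`
  (conclusion (i) of F-B2PL): at `a' = εa/2` the one-node member `F₁ = f₁ + a' g₂` (node `e_j`), the two-node member
  `F₂ = F₁ + ψ(a') g₀` (nodes `q`, `γ • q`), the phase-rescaled co-pencil forms `G₁ = u g₀`, `G₂ = −u g₀`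
  (`u = (ψ/2)/|ψ/2|`, non-vanishing at the nodes), the common radius `ε = |ψ(a')/2|` (punctured closed discs
  nonsingular), the base point `s ∈ S_M(ℂ)` of `F₁ + ε G₁ = F₂ + ε G₂`, and the two circles of F-B2PL realised as
  LOOPS OF `S_M(ℂ)` at `s` (`IsPencilCircle`), via the coefficient chart of `U(ℂ)` (`exists_path_pointForm_eq_add_smul`)
  and path lifting along the closed immersion `g_M` (`exists_path_lift_toBase`).
* §4 **`exists_confluence_at`** — GRANTED F-B2PL, everything read at an arbitrary base point `t ∈ S_M(ℂ)`: a path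
  `κ : t ⇝ s`, the transports `T₁, T₂ ∈ End Hⁿ(𝒴_{M,t}; ℚ)` of `π_M` along `κ·ω₁·κ⁻¹`, `κ·ω₂·κ⁻¹`, classes
  `e₁ e₂ e₃` and `c₀ ∈ ℚ` with `B_t(e₁, e₃) = 0`, `(c₀ B_t(e₁,e₂))² = (c₀ B_t(e₂,e₃))² = 1`,
  `T₁ = x ↦ x + c₀B_t(x,e₂)e₂`, `T₂ = x ↦ x + c₀B_t(x,e₁)e₁ + c₀B_t(x,e₃)e₃` — the input of the LINK algebra
  `SignSymmetricOrbitDataAssembly.exists_link_of_conjugate_confluence`.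

Sorry-free; axioms `propext`, `Classical.choice`, `Quot.sound`; no definition, no named fact (F-B2PL is an explicit
hypothesis of §4).

## References

* [ArnoldGuseinzadeVarchenko2012] Arnold, Gusein-Zade, Varchenko, Singularities of Differentiable Maps II, Part I
  §5.2 (boundary singularity `B₂`), §2.9 Thm. 2.15, §1.3.
* [VoisinHodgeII2003] C. Voisin, Hodge Theory and Complex Algebraic Geometry II (CUP 2003), §2.3.1, §3.1.2, §3.2.1
  Thm. 3.16, §3.2.2, §6.2.1.
* [SerreGAGA1956] J.-P. Serre, GAGA, §2 n°5.
-/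

noncomputable section

set_option linter.dupNamespace false

open CategoryTheory AlgebraicGeometry MvPolynomial
open scoped unitInterval
open Literature.AlgebraicTopology.SingularHomology
open Literature.AlgebraicGeometry.Motives Literature.AlgebraicGeometry.Motives.UniversalHypersurface
open Literature.AlgebraicGeometry.HodgeTheory Literature.AlgebraicGeometry.HodgeTheory.UniversalHypersurface
open Literature.AlgebraicGeometry.HodgeTheory.BettiUniverse
open Summit.HodgeConjecture.HodgeConjecture.Theorems.SignSymmetricPowersLinkTransport

namespace Summit.HodgeConjecture.HodgeConjecture.Theorems.SignSymmetricPowersLinkConfluence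

/-! ### §3 The two circles of the confluence as loops of `S_M(ℂ)` -/

section Loops

variable (n d : ℕ) (M : Set (DegIndex n d)) (γ : Fin (n + 2) → ℂˣ)

/-- The phase `2πiθ` has real part `0`, so `|r · e^{2πiθ}| = |r|`. [folklore] -/
theorem norm_mul_exp_two_pi_I (r : ℂ) (θ : I) :
    ‖r * Complex.exp (2 * Real.pi * Complex.I * ((θ : ℝ) : ℂ))‖ = ‖r‖ := by
  rw [norm_mul, Complex.norm_exp]
  have hre : (2 * (Real.pi : ℂ) * Complex.I * ((θ : ℝ) : ℂ)).re = 0 := by simp [Complex.mul_re]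
  rw [hre, Real.exp_zero, mul_one]

/-- The phase function `θ ↦ r e^{2πiθ}` is continuous. [folklore] -/
theorem continuous_mul_exp_two_pi_I (r : ℂ) :
    Continuous fun θ : I => r * Complex.exp (2 * Real.pi * Complex.I * ((θ : ℝ) : ℂ)) :=
  continuous_const.mul (Complex.continuous_exp.comp
    (continuous_const.mul (Complex.continuous_ofReal.comp continuous_subtype_val)))

/-- `e^{2πi·0} = 1` and `e^{2πi·1} = 1` on the unit interval. [folklore] -/
theorem exp_two_pi_I_zero_one :
    Complex.exp (2 * Real.pi * Complex.I * (((0 : I) : ℝ) : ℂ)) = 1 ∧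
      Complex.exp (2 * Real.pi * Complex.I * (((1 : I) : ℝ) : ℂ)) = 1 := by
  constructor
  · simp
  · rw [Set.Icc.coe_one, Complex.ofReal_one, mul_one, Complex.exp_two_pi_mul_I]

/-- **The two circles of the symmetric `A₃` confluence as loops of `S_M(ℂ)`.**  Let `(f₁, g₀, g₂, j, k, γ)` be a
symmetric `A₃` datum of `M`-supported degree-`d` forms (`γ` fixing the monomials of `M`; `g₀(q) = 0 ⇒ ∇g₀(q) = 0`,
e.g. `g₀ = x_j^d`) with bifurcation `(εa, εb, ψ)` (conclusion (i) of F-B2PL).  At `a' = εa/2`: the one-node member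
`F₁ = f₁ + a'g₂` (node `e_j`), the two-node member `F₂ = F₁ + ψ(a') g₀` (nodes `q`, `γ • q`, off `V(g₀)`), the
co-pencil forms `G₁ = u g₀`, `G₂ = −u g₀` (`u = (ψ(a')/2)/|ψ(a')/2|`), the radius `ε = |ψ(a')/2|` (punctured closed
discs nonsingular), the base point `s ∈ S_M(ℂ)` of the midpoint member `f₁ + a'g₂ + (ψ(a')/2) g₀ = F₁ + εG₁ = F₂ + εG₂`,
and loops `ω₁, ω₂` at `s` IN `S_M(ℂ)` which are the pencil circles of radius `ε` around `F₁` (direction `G₁`) and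
`F₂` (direction `G₂`) and whose forms are those of F-B2PL's circles `b = (ψ/2)e^{2πiθ}`, `b = ψ − (ψ/2)e^{2πiθ}`.
[cite: ArnoldGuseinzadeVarchenko2012, Part I §5.2] [cite: VoisinHodgeII2003, §2.3.1 and §6.2.1] [cite: SerreGAGA1956, §2 n°5] -/
theorem exists_confluenceLoops (hd : 1 ≤ d)
    {f₁ g₀ g₂ : MvPolynomial (Fin (n + 2)) ℂ} (hf₁ : f₁.IsHomogeneous d) (hg₀ : g₀.IsHomogeneous d)
    (hg₂ : g₂.IsHomogeneous d) (hM₁ : IsSupportedOn n d M f₁) (hM₀ : IsSupportedOn n d M g₀)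
    (hM₂ : IsSupportedOn n d M g₂) {j k : Fin (n + 2)} (hD : IsSymmetricA3Datum f₁ g₀ g₂ j k γ)
    (hg₀X : ∀ q : Fin (n + 2) → ℂ, MvPolynomial.eval q g₀ = 0 → ∀ i, MvPolynomial.eval q (pderiv i g₀) = 0)
    {εa εb : ℝ} {ψ : ℂ → ℂ} (hBif : IsSymmetricA3Bifurcation f₁ g₀ g₂ j γ εa εb ψ) :
    ∃ (a' : ℂ) (F₁ F₂ G₁ G₂ : MvPolynomial (Fin (n + 2)) ℂ) (q : Fin (n + 2) → ℂ) (ε : ℝ)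
      (s : ComplexPoints (baseM ℂ n d M)) (ω₁ ω₂ : Path s s),
      ‖a'‖ < εa ∧ a' ≠ 0 ∧
      pointFormM ℂ n d M s = f₁ + a' • g₂ + (ψ a' / 2) • g₀ ∧
      (∀ θ : I, pointFormM ℂ n d M (ω₁ θ) =
        f₁ + a' • g₂ + (ψ a' / 2 * Complex.exp (2 * Real.pi * Complex.I * ((θ : ℝ) : ℂ))) • g₀) ∧
      (∀ θ : I, pointFormM ℂ n d M (ω₂ θ) =
        f₁ + a' • g₂ + (ψ a' - ψ a' / 2 * Complex.exp (2 * Real.pi * Complex.I * ((θ : ℝ) : ℂ))) • g₀) ∧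
      F₁.IsHomogeneous d ∧ F₂.IsHomogeneous d ∧ G₁.IsHomogeneous d ∧ G₂.IsHomogeneous d ∧
      IsSupportedOn n d M F₁ ∧ IsSupportedOn n d M F₂ ∧ IsSupportedOn n d M G₁ ∧ IsSupportedOn n d M G₂ ∧
      IsNodalFormWithNodes F₁ ![Pi.single j (1 : ℂ)] ∧ MvPolynomial.eval (Pi.single j (1 : ℂ)) G₁ ≠ 0 ∧
      IsNodalFormWithNodes F₂ ![q, fun i => (γ i : ℂ) * q i] ∧
      (∀ i : Fin 2, MvPolynomial.eval ((![q, fun i => (γ i : ℂ) * q i] : Fin 2 → Fin (n + 2) → ℂ) i) G₂ ≠ 0) ∧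
      0 < ε ∧
      (∀ c : ℂ, c ≠ 0 → ‖c‖ ≤ ε → SmoothHypersurface.IsNonsingularForm ℂ (F₁ + c • G₁)) ∧
      (∀ c : ℂ, c ≠ 0 → ‖c‖ ≤ ε → SmoothHypersurface.IsNonsingularForm ℂ (F₂ + c • G₂)) ∧
      pointFormM ℂ n d M s = F₁ + ((ε : ℝ) : ℂ) • G₁ ∧ pointFormM ℂ n d M s = F₂ + ((ε : ℝ) : ℂ) • G₂ ∧
      IsPencilCircle n d F₁ G₁ ε (ω₁.map (AlgPoints.mapContinuous (toBase ℂ n d M)).continuous) ∧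
      IsPencilCircle n d F₂ G₂ ε (ω₂.map (AlgPoints.mapContinuous (toBase ℂ n d M)).continuous) := by
  have hBif' := hBif
  obtain ⟨hεa, hεb, -, -, hψ0, hψb, hiff, hnodes⟩ := hBif'
  -- the parameter `a' = εa / 2`
  set a' : ℂ := ((εa / 2 : ℝ) : ℂ) with ha'
  have ha : ‖a'‖ < εa := by
    rw [ha', Complex.norm_real, Real.norm_eq_abs, abs_of_pos (half_pos hεa)]; exact half_lt_self hεa
  have ha0 : a' ≠ 0 := by
    rw [ha']; exact_mod_cast (half_pos hεa).ne'
  have hψ : ψ a' ≠ 0 := hψ0 a' ha ha0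
  have hψ2 : ψ a' / 2 ≠ 0 := div_ne_zero hψ two_ne_zero
  have hψn : 0 < ‖ψ a'‖ := norm_pos_iff.2 hψ
  have hψ2n' : ‖ψ a' / 2‖ = ‖ψ a'‖ / 2 := by rw [norm_div, Complex.norm_two]
  -- the radius `ε` and the phase `u`
  obtain ⟨ε, hεdef⟩ : ∃ ε : ℝ, ε = ‖ψ a' / 2‖ := ⟨_, rfl⟩
  have hε2 : ε = ‖ψ a'‖ / 2 := by rw [hεdef, hψ2n']
  have hε : 0 < ε := by rw [hε2]; exact half_pos hψn
  have hε0 : ((ε : ℝ) : ℂ) ≠ 0 := by exact_mod_cast hε.ne'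
  obtain ⟨u, hudef⟩ : ∃ u : ℂ, u = ψ a' / 2 * ((ε : ℝ) : ℂ)⁻¹ := ⟨_, rfl⟩
  have hεu : ((ε : ℝ) : ℂ) * u = ψ a' / 2 := by rw [hudef]; field_simp
  have hu1 : ‖u‖ = 1 := by
    rw [hudef, norm_mul, norm_inv, Complex.norm_real, Real.norm_eq_abs, abs_of_pos hε, hεdef,
      mul_inv_cancel₀ (norm_ne_zero_iff.2 hψ2)]
  have hu0 : u ≠ 0 := fun h => by rw [h, norm_zero] at hu1; exact zero_ne_one hu1
  -- the forms
  set F₁ : MvPolynomial (Fin (n + 2)) ℂ := f₁ + a' • g₂ with hF₁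
  set F₂ : MvPolynomial (Fin (n + 2)) ℂ := f₁ + a' • g₂ + ψ a' • g₀ with hF₂
  set G₁ : MvPolynomial (Fin (n + 2)) ℂ := u • g₀ with hG₁
  set G₂ : MvPolynomial (Fin (n + 2)) ℂ := (-u) • g₀ with hG₂
  have hF₁h : F₁.IsHomogeneous d := isHomogeneous_add_smul hf₁ hg₂ a'
  have hF₂h : F₂.IsHomogeneous d := isHomogeneous_add_smul hF₁h hg₀ _
  have hG₁h : G₁.IsHomogeneous d := by simpa [hG₁] using isHomogeneous_add_smul (isHomogeneous_zero _ _ d) hg₀ u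
  have hG₂h : G₂.IsHomogeneous d := by
    simpa [hG₂] using isHomogeneous_add_smul (isHomogeneous_zero _ _ d) hg₀ (-u)
  have hF₁M : IsSupportedOn n d M F₁ := isSupportedOn_add hM₁ (isSupportedOn_smul hM₂ a')
  have hF₂M : IsSupportedOn n d M F₂ := isSupportedOn_add hF₁M (isSupportedOn_smul hM₀ _)
  have hG₁M : IsSupportedOn n d M G₁ := isSupportedOn_smul hM₀ u
  have hG₂M : IsSupportedOn n d M G₂ := isSupportedOn_smul hM₀ (-u)
  -- members of the `b`-line and their nonsingularity
  have hmem : ∀ b : ℂ, (f₁ + a' • g₂ + b • g₀).IsHomogeneous d ∧ IsSupportedOn n d M (f₁ + a' • g₂ + b • g₀) :=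
    fun b => ⟨isHomogeneous_add_smul hF₁h hg₀ b, isSupportedOn_add hF₁M (isSupportedOn_smul hM₀ b)⟩
  have hψεb : ‖ψ a'‖ < εb := by have := hψb a' ha; linarith [norm_nonneg (ψ a')]
  have hns : ∀ b : ℂ, ‖b‖ < εb → b ≠ 0 → b ≠ ψ a' →
      SmoothHypersurface.IsNonsingularForm ℂ (f₁ + a' • g₂ + b • g₀) :=
    fun b hb hb0 hbψ => (hiff a' b ha hb).mpr ⟨hb0, hbψ⟩
  have hline₁ : ∀ c : ℂ, F₁ + c • G₁ = f₁ + a' • g₂ + (c * u) • g₀ := fun c => by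
    rw [hG₁, smul_smul]
  have hline₂ : ∀ c : ℂ, F₂ + c • G₂ = f₁ + a' • g₂ + (ψ a' - c * u) • g₀ := fun c => by
    rw [hG₂, smul_smul, hF₂, sub_smul, mul_neg, neg_smul]; abel
  have hns₁ : ∀ c : ℂ, c ≠ 0 → ‖c‖ ≤ ε → SmoothHypersurface.IsNonsingularForm ℂ (F₁ + c • G₁) := by
    intro c hc hcε
    have hcu : ‖c * u‖ ≤ ε := by rw [norm_mul, hu1, mul_one]; exact hcε
    rw [hε2] at hcu
    rw [hline₁]
    refine hns _ (by linarith) (mul_ne_zero hc hu0) ?_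
    intro h
    rw [h] at hcu
    linarith
  have hns₂ : ∀ c : ℂ, c ≠ 0 → ‖c‖ ≤ ε → SmoothHypersurface.IsNonsingularForm ℂ (F₂ + c • G₂) := by
    intro c hc hcε
    have hcu : ‖c * u‖ ≤ ε := by rw [norm_mul, hu1, mul_one]; exact hcε
    rw [hε2] at hcu
    rw [hline₂]
    refine hns _ ?_ ?_ ?_
    · calc ‖ψ a' - c * u‖ ≤ ‖ψ a'‖ + ‖c * u‖ := norm_sub_le _ _
        _ < εb := by have := hψb a' ha; linarith
    · intro h
      rw [sub_eq_zero] at h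
      rw [← h] at hcu
      linarith
    · intro h
      have : c * u = 0 := by linear_combination -h
      exact mul_ne_zero hc hu0 this
  -- the base point
  have hmid := hmem (ψ a' / 2)
  have hmidns : SmoothHypersurface.IsNonsingularForm ℂ (f₁ + a' • g₂ + (ψ a' / 2) • g₀) :=
    hBif.isNonsingularForm_midpoint ha ha0
  set s := pointOfFormM ℂ n d M hmid.1 hmidns hmid.2 with hsdef
  have hs : pointFormM ℂ n d M s = f₁ + a' • g₂ + (ψ a' / 2) • g₀ := pointFormM_pointOfFormM ℂ n d M hmid.1 _ hmid.2
  -- the two loops in `U(ℂ)`, lifted to `S_M(ℂ)`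
  set c₁ : I → ℂ := fun θ => ψ a' / 2 * Complex.exp (2 * Real.pi * Complex.I * ((θ : ℝ) : ℂ)) with hc₁
  set c₂ : I → ℂ := fun θ => ψ a' - ψ a' / 2 * Complex.exp (2 * Real.pi * Complex.I * ((θ : ℝ) : ℂ)) with hc₂
  have hc₁n : ∀ θ, ‖c₁ θ‖ = ‖ψ a' / 2‖ := fun θ => norm_mul_exp_two_pi_I _ θ
  have hψ2n : ‖ψ a' / 2‖ < ‖ψ a'‖ := by rw [hψ2n']; linarith
  have hJ₁ : ∀ θ, SmoothHypersurface.IsNonsingularForm ℂ (F₁ + c₁ θ • g₀) := fun θ => by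
    refine hns _ (by rw [hc₁n]; linarith) (by rw [← norm_ne_zero_iff, hc₁n]; exact norm_ne_zero_iff.2 hψ2) ?_
    intro h; have := hc₁n θ; rw [h] at this; linarith
  have hJ₂ : ∀ θ, SmoothHypersurface.IsNonsingularForm ℂ (F₁ + c₂ θ • g₀) := fun θ => by
    have h2 : c₂ θ = ψ a' - c₁ θ := rfl
    refine hns _ ?_ ?_ ?_
    · calc ‖c₂ θ‖ = ‖ψ a' - c₁ θ‖ := by rw [h2]
        _ ≤ ‖ψ a'‖ + ‖c₁ θ‖ := norm_sub_le _ _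
        _ < εb := by rw [hc₁n]; have := hψb a' ha; linarith
    · rw [h2, sub_ne_zero]; intro h; have := hc₁n θ; rw [← h] at this; linarith
    · rw [h2]; intro h
      have h0 : c₁ θ = 0 := by linear_combination -h
      have := hc₁n θ
      rw [h0, norm_zero] at this
      exact norm_ne_zero_iff.2 hψ2 this.symm
  -- the base point in `U(ℂ)`
  have hc₁0 : c₁ 0 = ψ a' / 2 := by simp only [hc₁, exp_two_pi_I_zero_one.1, mul_one]
  have hc₂0 : c₂ 0 = ψ a' / 2 := by simp only [hc₂, exp_two_pi_I_zero_one.1, mul_one]; ring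
  have hs₁ : pointForm ℂ n d (AlgPoints.map (toBase ℂ n d M) s) = F₁ + c₁ 0 • g₀ := by
    change pointFormM ℂ n d M s = _
    rw [hs, hc₁0]
  have hs₂ : pointForm ℂ n d (AlgPoints.map (toBase ℂ n d M) s) = F₁ + c₂ 0 • g₀ := by
    change pointFormM ℂ n d M s = _
    rw [hs, hc₂0]
  have hc₁01 : c₁ 0 = c₁ 1 := by
    simp only [hc₁, exp_two_pi_I_zero_one.1, exp_two_pi_I_zero_one.2]
  have hc₂01 : c₂ 0 = c₂ 1 := by
    simp only [hc₂, exp_two_pi_I_zero_one.1, exp_two_pi_I_zero_one.2]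
  have hc₁c : Continuous c₁ := by rw [hc₁]; exact continuous_mul_exp_two_pi_I _
  have hc₂c : Continuous c₂ := by rw [hc₂]; exact continuous_const.sub (continuous_mul_exp_two_pi_I _)
  obtain ⟨γ₁, hγ₁⟩ := exists_path_pointForm_eq_add_smul n d hF₁h hg₀ (c := c₁) hc₁c hc₁01 hJ₁ _ hs₁
  obtain ⟨γ₂, hγ₂⟩ := exists_path_pointForm_eq_add_smul n d hF₁h hg₀ (c := c₂) hc₂c hc₂01 hJ₂ _ hs₂
  -- lift them to `S_M(ℂ)`
  obtain ⟨ω₁, hω₁⟩ := exists_path_lift_toBase ℂ n d M γ₁ fun θ => by rw [hγ₁ θ]; exact (hmem _).2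
  obtain ⟨ω₂, hω₂⟩ := exists_path_lift_toBase ℂ n d M γ₂ fun θ => by rw [hγ₂ θ]; exact (hmem _).2
  have hω₁f : ∀ θ : I, pointFormM ℂ n d M (ω₁ θ) = F₁ + c₁ θ • g₀ := fun θ => by
    change pointForm ℂ n d (AlgPoints.map (toBase ℂ n d M) (ω₁ θ)) = _
    rw [hω₁ θ, hγ₁ θ]
  have hω₂f : ∀ θ : I, pointFormM ℂ n d M (ω₂ θ) = F₁ + c₂ θ • g₀ := fun θ => by
    change pointForm ℂ n d (AlgPoints.map (toBase ℂ n d M) (ω₂ θ)) = _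
    rw [hω₂ θ, hγ₂ θ]
  -- the nodes
  obtain ⟨hnod₁, q, hnod₂, tq, htq⟩ := hnodes a' ha ha0
  have hq0 : q 0 ≠ 0 := (hnod₂.1 0).ne_zero
  have htq0 : tq ≠ 0 := by
    rintro rfl
    rw [zero_smul] at htq
    exact hq0 (funext fun i => by simpa [Units.smul_def] using congr_fun htq i)
  -- the nodes of `F₂`, presented as `q₀, γ • q₀`
  have hnod₂' : IsNodalFormWithNodes F₂ ![q 0, fun i => (γ i : ℂ) * q 0 i] := by
    refine isNodalFormWithNodes_of_smul_nodes hF₂h hnod₂ ![1, tq] (fun i => by fin_cases i <;> simp [htq0])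
      fun i => ?_
    fin_cases i
    · simp
    · change (fun i => (γ i : ℂ) * q 0 i) = tq • q 1
      rw [← htq]
      funext i
      simp [Units.smul_def]
  -- `g₀` does not vanish at the nodes of `F₂` (else the midpoint member would be singular there)
  have hmideq : f₁ + a' • g₂ + (ψ a' / 2) • g₀ = F₂ + (-(ψ a' / 2)) • g₀ := by
    rw [hF₂, add_assoc (f₁ + a' • g₂), ← add_smul]
    congr 2
    ring
  have hg₀node : ∀ Q, IsOrdinaryDoublePointOf F₂ Q → MvPolynomial.eval Q g₀ ≠ 0 := by
    intro Q hQ h0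
    have hgrad := hg₀X Q h0
    have hmidQ : MvPolynomial.eval Q (f₁ + a' • g₂ + (ψ a' / 2) • g₀) = 0 := by
      rw [hmideq, map_add, hQ.eval_eq_zero hF₂h hd, smul_eval, h0, mul_zero, add_zero]
    obtain ⟨i, hi⟩ := hmidns.exists_eval_pderiv_ne_zero hQ.ne_zero hmidQ
    apply hi
    rw [hmideq, map_add, (pderiv i).map_smul, map_add, hQ.eval_pderiv i, smul_eval, hgrad i, mul_zero, add_zero]
  have hG₁e : MvPolynomial.eval (Pi.single j (1 : ℂ)) G₁ ≠ 0 := by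
    rw [hG₁, smul_eval]; exact mul_ne_zero hu0 hD.eval_g₀_ne
  have hG₂q : ∀ i : Fin 2, MvPolynomial.eval ((![q 0, fun i => (γ i : ℂ) * q 0 i] : Fin 2 → Fin (n + 2) → ℂ) i) G₂ ≠ 0 := by
    intro i
    rw [hG₂, smul_eval]
    exact mul_ne_zero (neg_ne_zero.2 hu0) (hg₀node _ (hnod₂'.1 i))
  -- the pencil-circle descriptions
  have hsF₁ : pointFormM ℂ n d M s = F₁ + ((ε : ℝ) : ℂ) • G₁ := by rw [hs, hG₁, smul_smul, hεu]
  have hsF₂ : pointFormM ℂ n d M s = F₂ + ((ε : ℝ) : ℂ) • G₂ := by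
    rw [hs, hG₂, smul_smul, mul_neg, hεu, hmideq]
  have hpc₁ : IsPencilCircle n d F₁ G₁ ε (ω₁.map (AlgPoints.mapContinuous (toBase ℂ n d M)).continuous) := by
    intro θ
    change pointFormM ℂ n d M (ω₁ θ) = _
    rw [hω₁f θ, hG₁, smul_smul]
    congr 2
    change ψ a' / 2 * _ = _
    rw [← hεu]; ring
  have hpc₂ : IsPencilCircle n d F₂ G₂ ε (ω₂.map (AlgPoints.mapContinuous (toBase ℂ n d M)).continuous) := by
    intro θ
    change pointFormM ℂ n d M (ω₂ θ) = _
    rw [hω₂f θ, hG₂, smul_smul, hF₂, add_assoc (f₁ + a' • g₂), ← add_smul]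
    congr 2
    change ψ a' - ψ a' / 2 * _ = _
    rw [← hεu]; ring
  exact ⟨a', F₁, F₂, G₁, G₂, q 0, ε, s, ω₁, ω₂, ha, ha0, hs, hω₁f, hω₂f, hF₁h, hF₂h, hG₁h, hG₂h, hF₁M, hF₂M, hG₁M,
    hG₂M, hnod₁, hG₁e, hnod₂', hG₂q, hε, hns₁, hns₂, hsF₁, hsF₂, hpc₁, hpc₂⟩

end Loops

/-! ### §4 The confluence read at a base point -/

section Main

variable (n d : ℕ) (M : Set (DegIndex n d)) (γ : Fin (n + 2) → ℂˣ)

/-- **The symmetric `A₃` confluence read at a base point.**  GRANTED F-B2PL (`picardLefschetz_symmetricA3`): for a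
symmetric `A₃` datum `(f₁, g₀, g₂, j, k, γ)` of `M`-supported degree-`d` forms (`n, d ≥ 1`, `γ` fixing the monomials of
`M`, `g₀(q) = 0 ⇒ ∇g₀(q) = 0`) and every base point `t ∈ S_M(ℂ)`, there are: the one-node member `F₁` (node `e_j`) and
the two-node member `F₂` (nodes `q`, `γ • q`) of the confluence with co-pencil forms `G₁, G₂` (non-vanishing at the
nodes), a radius `ε > 0` (punctured closed discs nonsingular), the base point `s` of `F₁ + εG₁ = F₂ + εG₂`, pencil
circles `ω₁, ω₂` at `s` in `S_M(ℂ)` around `F₁, F₂`, a path `κ : t ⇝ s`, the rational transports `T₁, T₂` of `π_M`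
(degree `n`) along `κ·ω₁·κ⁻¹`, `κ·ω₂·κ⁻¹`, and classes `e₁ e₂ e₃ ∈ Hⁿ(𝒴_{M,t}; ℚ)`, `c₀ ∈ ℚ` with
`B_t(e₁, e₃) = 0`, `(c₀B_t(e₁,e₂))² = (c₀B_t(e₂,e₃))² = 1`, `T₁ = x ↦ x + c₀B_t(x,e₂)e₂` and
`T₂ = x ↦ x + c₀B_t(x,e₁)e₁ + c₀B_t(x,e₃)e₃` (`B_t = tr_t ∘ ∪`): the `A₃` chain and the two local monodromies of
F-B2PL, transported to `t`.  [cite: ArnoldGuseinzadeVarchenko2012, Part I §5.2 and §2.9 Thm. 2.15]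
[cite: VoisinHodgeII2003, §3.2.1 Thm. 3.16 and §3.2.2] -/
theorem exists_confluence_at (hB2 : picardLefschetz_symmetricA3) (hn : 1 ≤ n) (hd : 1 ≤ d)
    (hγ : FixesMonomials ℂ n d M γ) (hU : IsCohomologicallyLocallyTrivialOn (familyM ℂ n d M) Set.univ)
    {f₁ g₀ g₂ : MvPolynomial (Fin (n + 2)) ℂ} (hf₁ : f₁.IsHomogeneous d) (hg₀ : g₀.IsHomogeneous d)
    (hg₂ : g₂.IsHomogeneous d) (hM₁ : IsSupportedOn n d M f₁) (hM₀ : IsSupportedOn n d M g₀)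
    (hM₂ : IsSupportedOn n d M g₂) {j k : Fin (n + 2)} (hD : IsSymmetricA3Datum f₁ g₀ g₂ j k γ)
    (hg₀X : ∀ q : Fin (n + 2) → ℂ, MvPolynomial.eval q g₀ = 0 → ∀ i, MvPolynomial.eval q (pderiv i g₀) = 0)
    (t : ComplexPoints (baseM ℂ n d M)) :
    ∃ (F₁ F₂ G₁ G₂ : MvPolynomial (Fin (n + 2)) ℂ) (q : Fin (n + 2) → ℂ) (ε : ℝ)
      (s : ComplexPoints (baseM ℂ n d M)) (κ : Path t s) (ω₁ ω₂ : Path s s)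
      (T₁ T₂ : bettiCohomology (fiberOver (familyM ℂ n d M) t) n ≃ₗ[ℚ] bettiCohomology (fiberOver (familyM ℂ n d M) t) n)
      (e₁ e₂ e₃ : bettiCohomology (fiberOver (familyM ℂ n d M) t) n) (c₀ : ℚ),
      F₁.IsHomogeneous d ∧ F₂.IsHomogeneous d ∧ G₁.IsHomogeneous d ∧ G₂.IsHomogeneous d ∧
      IsSupportedOn n d M F₁ ∧ IsSupportedOn n d M F₂ ∧ IsSupportedOn n d M G₁ ∧ IsSupportedOn n d M G₂ ∧
      IsNodalFormWithNodes F₁ ![Pi.single j (1 : ℂ)] ∧ MvPolynomial.eval (Pi.single j (1 : ℂ)) G₁ ≠ 0 ∧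
      IsNodalFormWithNodes F₂ ![q, fun i => (γ i : ℂ) * q i] ∧
      (∀ i : Fin 2, MvPolynomial.eval ((![q, fun i => (γ i : ℂ) * q i] : Fin 2 → Fin (n + 2) → ℂ) i) G₂ ≠ 0) ∧
      0 < ε ∧
      (∀ c : ℂ, c ≠ 0 → ‖c‖ ≤ ε → SmoothHypersurface.IsNonsingularForm ℂ (F₁ + c • G₁)) ∧
      (∀ c : ℂ, c ≠ 0 → ‖c‖ ≤ ε → SmoothHypersurface.IsNonsingularForm ℂ (F₂ + c • G₂)) ∧
      pointFormM ℂ n d M s = F₁ + ((ε : ℝ) : ℂ) • G₁ ∧ pointFormM ℂ n d M s = F₂ + ((ε : ℝ) : ℂ) • G₂ ∧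
      IsPencilCircle n d F₁ G₁ ε (ω₁.map (AlgPoints.mapContinuous (toBase ℂ n d M)).continuous) ∧
      IsPencilCircle n d F₂ G₂ ε (ω₂.map (AlgPoints.mapContinuous (toBase ℂ n d M)).continuous) ∧
      IsRatTransport (familyM ℂ n d M) n hU ⟦((κ.trans ω₁).trans κ.symm).map
        (⟨fun s => ⟨s, Set.mem_univ s⟩, continuous_id.subtype_mk _⟩ :
          C(ComplexPoints (baseM ℂ n d M), (Set.univ : Set (ComplexPoints (baseM ℂ n d M))))).continuous⟧ T₁ ∧
      IsRatTransport (familyM ℂ n d M) n hU ⟦((κ.trans ω₂).trans κ.symm).map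
        (⟨fun s => ⟨s, Set.mem_univ s⟩, continuous_id.subtype_mk _⟩ :
          C(ComplexPoints (baseM ℂ n d M), (Set.univ : Set (ComplexPoints (baseM ℂ n d M))))).continuous⟧ T₂ ∧
      tr (isSmoothProjective_fiberOver_familyM ℂ n d M hn hd t) (n + n)
        (cup (fiberOver (familyM ℂ n d M) t) n n e₁ e₃) = 0 ∧
      (c₀ * tr (isSmoothProjective_fiberOver_familyM ℂ n d M hn hd t) (n + n)
        (cup (fiberOver (familyM ℂ n d M) t) n n e₁ e₂)) ^ 2 = 1 ∧
      (c₀ * tr (isSmoothProjective_fiberOver_familyM ℂ n d M hn hd t) (n + n)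
        (cup (fiberOver (familyM ℂ n d M) t) n n e₂ e₃)) ^ 2 = 1 ∧
      (∀ x, T₁ x = x + (c₀ * tr (isSmoothProjective_fiberOver_familyM ℂ n d M hn hd t) (n + n)
        (cup (fiberOver (familyM ℂ n d M) t) n n x e₂)) • e₂) ∧
      (∀ x, T₂ x = x + (c₀ * tr (isSmoothProjective_fiberOver_familyM ℂ n d M hn hd t) (n + n)
        (cup (fiberOver (familyM ℂ n d M) t) n n x e₁)) • e₁ +
        (c₀ * tr (isSmoothProjective_fiberOver_familyM ℂ n d M hn hd t) (n + n)
          (cup (fiberOver (familyM ℂ n d M) t) n n x e₃)) • e₃) := by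
  have hUU := UniversalHypersurface.isCohomologicallyLocallyTrivialOn_family n d hd
  -- F-B2PL
  obtain ⟨εa, εb, ψ, hBif, hPL⟩ := hB2 n d f₁ g₀ g₂ j k γ hf₁ hg₀ hg₂ hD
  -- the loops of the confluence in `S_M(ℂ)`
  obtain ⟨a', F₁, F₂, G₁, G₂, q, ε, s, ω₁, ω₂, ha, ha0, hs, hω₁f, hω₂f, hF₁h, hF₂h, hG₁h, hG₂h, hF₁M, hF₂M, hG₁M,
    hG₂M, hnod₁, hG₁e, hnod₂, hG₂q, hε, hns₁, hns₂, hsF₁, hsF₂, hpc₁, hpc₂⟩ :=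
    exists_confluenceLoops n d M γ hd hf₁ hg₀ hg₂ hM₁ hM₀ hM₂ hD hg₀X hBif
  -- F-B2PL (ii) at the image loops
  have hPL' := hPL hn hd hUU a' ha ha0 (AlgPoints.map (toBase ℂ n d M) s) hs
    (ω₁.map (AlgPoints.mapContinuous (toBase ℂ n d M)).continuous)
    (ω₂.map (AlgPoints.mapContinuous (toBase ℂ n d M)).continuous) hω₁f hω₂f
  obtain ⟨c₀, e₁, e₂, e₃, hPL₁, hPL₂, h12, h23, -⟩ := hPL'
  -- a path from `t` to `s`, and the transport datum along it
  haveI := pathConnectedSpace_complexPoints_baseM n d M t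
  let κ : Path t s := (PathConnectedSpace.joined t s).somePath
  obtain ⟨Φ, ρ, ν, hρ, hν, hρν, hsim, -, htrans⟩ := exists_transportDatum n d M γ hn hd hγ hUU hU κ
  obtain ⟨T₁, hT₁, hT₁x⟩ := htrans 1 ω₁ ![e₂] c₀ hPL₁
  obtain ⟨T₂, hT₂, hT₂x⟩ := htrans 2 ω₂ ![e₁, e₃] c₀ hPL₂
  refine ⟨F₁, F₂, G₁, G₂, q, ε, s, κ, ω₁, ω₂, T₁, T₂, Φ e₁, Φ e₂, Φ e₃, c₀ * ρ, hF₁h, hF₂h, hG₁h, hG₂h, hF₁M, hF₂M,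
    hG₁M, hG₂M, hnod₁, hG₁e, hnod₂, hG₂q, hε, hns₁, hns₂, hsF₁, hsF₂, hpc₁, hpc₂, hT₁, hT₂, ?_, ?_, ?_,
    fun x => ?_, fun x => ?_⟩
  · have h13 := hPL₂.orthogonal (show (0 : Fin 2) ≠ 1 by decide)
    simp only [Matrix.cons_val_zero, Matrix.cons_val_one] at h13
    rw [hsim, h13, mul_zero]
  · beta_reduce at h12
    rw [hsim, ← mul_assoc, mul_assoc c₀ ρ ν, hρν, mul_one]
    rcases h12 with h | h <;> rw [h] <;> norm_num
  · beta_reduce at h23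
    rw [hsim, ← mul_assoc, mul_assoc c₀ ρ ν, hρν, mul_one]
    rcases h23 with h | h <;> rw [h] <;> norm_num
  · rw [hT₁x x, Fin.sum_univ_one, Matrix.cons_val_zero, smul_smul]
  · rw [hT₂x x, Fin.sum_univ_two, Matrix.cons_val_zero, Matrix.cons_val_one, Matrix.cons_val_zero, smul_add,
      smul_smul, smul_smul, add_assoc]

end Main

end Summit.HodgeConjecture.HodgeConjecture.Theorems.SignSymmetricPowersLinkConfluence

end
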